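import Mathlib
import Literature.Analysis.FluidPDE.VectorCalculus

/-!
# Tool stub `stub_steadyEulerCommutesWithCurl` of the line `Sketch`
# (crux `DyadicWallCascade.HalfSpaceHierarchy`, item stmt-AnomalousDissipation-18627)

Sorry-free discharge of the registered tool stub `stub_steadyEulerCommutesWithCurl` of the lead's
skeleton (card `flat-bernoulli-leaves`, dossier (L1): the starting point of Arnold's structure theory
of steady Euler flows is that velocity and vorticity commute as vector fields).

**Statement (steady vorticity equation / commuting frame).**  Let `U ⊆ ℝ³` be open, let
`V : ℝ³ → ℝ³` and `Q : ℝ³ → ℝ` be `C²` on `U`, and suppose that on `U` the field is divergence free,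
`Σᵢ ∂ᵢVᵢ = 0`, and satisfies the steady incompressible Euler momentum equation
`DV(X)[V X] + ∇Q(X) = 0` (`(V·∇)V + ∇Q = 0`).  Then, with `ω = curl V`
(the tree's `Literature.Analysis.FluidPDE.curl`), on `U`
`D(curl V)(X)[V X] − DV(X)[curl V X] = 0`, i.e. `(V·∇)ω − (ω·∇)V = [V, ω] = 0`.

**Proof (index computation).**  Fix `X ∈ U` and write `eⱼ = EuclideanSpace.single j 1`,
`vⱼ = (V X)ⱼ`, `aⱼₖ = (DV(X) eⱼ)ₖ = ∂ⱼVₖ`, `bₘⱼₖ = (D²V(X) eₘ eⱼ)ₖ = ∂ₘ∂ⱼVₖ`,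
`qₘₖ = D²Q(X) eₘ eₖ = ∂ₘ∂ₖQ`; `ω₀ = a₁₂ − a₂₁`, `ω₁ = a₂₀ − a₀₂`, `ω₂ = a₀₁ − a₁₀`.
* Regularity: `U ∈ 𝓝 X`, so `V`, `Q` are `C²` at `X`; hence `DV`, `DQ` are differentiable at `X`
  and the second derivatives are symmetric, `bₘⱼₖ = bⱼₘₖ`, `qₘₖ = qₖₘ`
  (Mathlib's `ContDiffAt.isSymmSndFDerivAt`).
* `curl V = C ∘ DV` for a fixed continuous linear map `C` of the Jacobian (`exists_curl_clm`), so by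
  the chain rule `D(curl V)(X) h = C (D²V(X) h)`; with `h = V X = Σⱼ vⱼ eⱼ` the first coordinate of
  `(V·∇)ω` is `Σⱼ vⱼ (bⱼ₁₂ − bⱼ₂₁)` (`fderiv_curl_apply`, `clm₂_apply_coord`).
* `(ω·∇)V` has coordinates `(DV(X) ω)ᵢ = Σₗ ωₗ aₗᵢ` (`clm_apply_coord`).
* The Euler expression `Y ↦ DV(Y)[V Y] + ∇Q(Y)` vanishes on the neighbourhood `U` of `X`, so its
  derivative at `X` vanishes; by the product rule for the evaluation `(DV(Y))(V Y)`
  (Mathlib's `HasFDerivAt.clm_apply`) and `(D(∇Q)(X) h)ₖ = D²Q(X) h eₖ` (`fderiv_gradient_apply`),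
  its derivative along `eₘ`, coordinate `k`, reads
  `E(m,k) : Σⱼ aₘⱼ aⱼₖ + Σⱼ vⱼ bₘⱼₖ + qₘₖ = 0` (`fderiv_euler_apply`).
* Assembly, first coordinate: by the symmetries, the `v`-terms of `E(1,2) − E(2,1)` are exactly
  `Σⱼ vⱼ (bⱼ₁₂ − bⱼ₂₁)` and the `q`-terms cancel, so
  `[(V·∇)ω − (ω·∇)V]₀ = −Σⱼ (a₁ⱼ aⱼ₂ − a₂ⱼ aⱼ₁) − (ω₀ a₀₀ + ω₁ a₁₀ + ω₂ a₂₀)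
  = −(a₁₂ − a₂₁)(a₀₀ + a₁₁ + a₂₂) = 0` by `div V (X) = 0` (expand: all other monomials cancel in
  pairs).  The other two coordinates are the cyclic permutations (`E(2,0) − E(0,2)`,
  `E(0,1) − E(1,0)`); each is closed by `linear_combination`.

Sources: V. I. Arnold, B. A. Khesin, *Topological Methods in Hydrodynamics*, Springer (1998), Ch. II
§1 (steady flows: `[v, curl v] = 0`, Thm. 1.2 and its proof); A. J. Majda, A. L. Bertozzi,
*Vorticity and Incompressible Flow*, CUP (2002), §1.1–1.2 (vorticity equation (1.32)–(1.33):
`Dω/Dt = (ω·∇)v`); folklore.  No named facts are used; the only tree import is `VectorCalculus.lean`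
(for `curl`).  Deliberately NOT here: the time-dependent vorticity equation, the converse statement,
and any integrability (Arnold) consequences of the commutation.
-/

set_option linter.dupNamespace false

open WithLp Filter Topology
open scoped InnerProductSpace RealInnerProductSpace
open Literature.Analysis.FluidPDE

noncomputable section

namespace Summit.AnomalousDissipation.AnomalousDissipation.Theorems.HalfSpaceHierarchy

/-- Coordinates of a gradient on `ℝ³` are the directional derivatives along the standard basis,
`(∇f X)ᵢ = Df(X) eᵢ` with `eᵢ = EuclideanSpace.single i 1` (Riesz representation, Mathlib's
`InnerProductSpace.toDual_symm_apply`); valid at every point (both sides are junk `0` where `f` is not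
differentiable). [folklore] -/
private theorem gradient_coord (f : EuclideanSpace ℝ (Fin 3) → ℝ) (X : EuclideanSpace ℝ (Fin 3))
    (i : Fin 3) : gradient f X i = fderiv ℝ f X (EuclideanSpace.single i 1) := by
  have h1 : ⟪gradient f X, EuclideanSpace.single i (1 : ℝ)⟫ = gradient f X i := by
    simp only [EuclideanSpace.inner_single_right, one_mul, RCLike.conj_to_real]
  rw [← h1, gradient, InnerProductSpace.toDual_symm_apply]

/-- Expansion of a continuous linear map of `ℝ³` in standard coordinates,
`(L v)ᵢ = Σⱼ vⱼ (L eⱼ)ᵢ`, from `v = Σⱼ vⱼ eⱼ` (`EuclideanSpace.basisFun`) and linearity. [folklore] -/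
private theorem clm_apply_coord (L : EuclideanSpace ℝ (Fin 3) →L[ℝ] EuclideanSpace ℝ (Fin 3))
    (v : EuclideanSpace ℝ (Fin 3)) (i : Fin 3) :
    L v i = ∑ j, v j * L (EuclideanSpace.single j 1) i := by
  have hv : v = ∑ j, v j • EuclideanSpace.single j (1 : ℝ) := by
    simpa using ((EuclideanSpace.basisFun (Fin 3) ℝ).sum_repr v).symm
  conv_lhs => rw [hv]
  simp [map_sum, map_smul, Finset.sum_apply]

/-- Expansion of a continuous bilinear map of `ℝ³` (a second derivative `D²V(X)`) in its first
argument, `(D v w)ₖ = Σⱼ vⱼ (D eⱼ w)ₖ`, from `v = Σⱼ vⱼ eⱼ` and linearity in `v`. [folklore] -/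
private theorem clm₂_apply_coord
    (D : EuclideanSpace ℝ (Fin 3) →L[ℝ] EuclideanSpace ℝ (Fin 3) →L[ℝ] EuclideanSpace ℝ (Fin 3))
    (v w : EuclideanSpace ℝ (Fin 3)) (k : Fin 3) :
    D v w k = ∑ j, v j * D (EuclideanSpace.single j 1) w k := by
  have hv : v = ∑ j, v j • EuclideanSpace.single j (1 : ℝ) := by
    simpa using ((EuclideanSpace.basisFun (Fin 3) ℝ).sum_repr v).symm
  conv_lhs => rw [hv]
  simp [map_sum, map_smul, Finset.sum_apply]

/-- The curl is a fixed continuous linear map `C` of the Jacobian: there is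
`C : (ℝ³ →L ℝ³) →L ℝ³` with `C L = (L₁₂ − L₂₁, L₂₀ − L₀₂, L₀₁ − L₁₀)` (`Lⱼᵢ = (L eⱼ)ᵢ`), so that
`curl v x = C (Dv(x))` by the very definition of `curl` (Majda–Bertozzi, §1.2, eq. (1.20)); linearity is
checked coordinatewise, continuity is automatic in finite dimension
(`LinearMap.toContinuousLinearMap`).  Same map as the tree's `curlCLM` of
`Literature/Analysis/FluidPDE/TaoEnstrophyLocalisation.lean`, re-derived here as an existence statement
to keep this file's tree imports to `VectorCalculus`. [folklore] -/
private theorem exists_curl_clm :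
    ∃ C : (EuclideanSpace ℝ (Fin 3) →L[ℝ] EuclideanSpace ℝ (Fin 3)) →L[ℝ] EuclideanSpace ℝ (Fin 3),
      ∀ L : EuclideanSpace ℝ (Fin 3) →L[ℝ] EuclideanSpace ℝ (Fin 3),
        C L = toLp 2 ![L (EuclideanSpace.single 1 1) 2 - L (EuclideanSpace.single 2 1) 1,
          L (EuclideanSpace.single 2 1) 0 - L (EuclideanSpace.single 0 1) 2,
          L (EuclideanSpace.single 0 1) 1 - L (EuclideanSpace.single 1 1) 0] := by
  refine ⟨LinearMap.toContinuousLinearMap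
    { toFun := fun L => toLp 2 ![L (EuclideanSpace.single 1 1) 2 - L (EuclideanSpace.single 2 1) 1,
          L (EuclideanSpace.single 2 1) 0 - L (EuclideanSpace.single 0 1) 2,
          L (EuclideanSpace.single 0 1) 1 - L (EuclideanSpace.single 1 1) 0]
      map_add' := fun L L' => ?_
      map_smul' := fun c L => ?_ }, fun L => rfl⟩
  · ext i
    fin_cases i <;> simp <;> ring
  · ext i
    fin_cases i <;> simp <;> ring

/-- Chain rule for the curl of a field `V` that is `C²` at `X`:
`D(curl V)(X) h = (D²V(X) h e₁ · e₂ − D²V(X) h e₂ · e₁, …)`, i.e. `D(curl V)(X) = C ∘ D²V(X)` with the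
linear map `C` of `exists_curl_clm` (Mathlib's chain rule `HasFDerivAt.comp` for the continuous linear
map `C` and the differentiability of `DV` at `X`, `ContDiffAt.fderiv_right`). [folklore] -/
private theorem fderiv_curl_apply {V : EuclideanSpace ℝ (Fin 3) → EuclideanSpace ℝ (Fin 3)}
    {X : EuclideanSpace ℝ (Fin 3)} (hV : ContDiffAt ℝ 2 V X) (h : EuclideanSpace ℝ (Fin 3)) :
    fderiv ℝ (curl V) X h =
      toLp 2 ![fderiv ℝ (fderiv ℝ V) X h (EuclideanSpace.single 1 1) 2
          - fderiv ℝ (fderiv ℝ V) X h (EuclideanSpace.single 2 1) 1,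
        fderiv ℝ (fderiv ℝ V) X h (EuclideanSpace.single 2 1) 0
          - fderiv ℝ (fderiv ℝ V) X h (EuclideanSpace.single 0 1) 2,
        fderiv ℝ (fderiv ℝ V) X h (EuclideanSpace.single 0 1) 1
          - fderiv ℝ (fderiv ℝ V) X h (EuclideanSpace.single 1 1) 0] := by
  obtain ⟨C, hC⟩ := exists_curl_clm
  have hcurl : curl V = C ∘ fderiv ℝ V := by
    funext Y
    rw [Function.comp_apply, hC]
    rfl
  have hD : HasFDerivAt (fderiv ℝ V) (fderiv ℝ (fderiv ℝ V) X) X :=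
    ((hV.fderiv_right (m := 1) (by norm_num)).differentiableAt one_ne_zero).hasFDerivAt
  rw [hcurl, (C.hasFDerivAt.comp X hD).fderiv, ContinuousLinearMap.comp_apply, hC]

/-- Derivative of the gradient field of a function `Q` that is `C²` at `X`: `∇Q` is differentiable at
`X` and `(D(∇Q)(X) h)ₖ = D²Q(X) h eₖ`.  Coordinates of `∇Q` are the directional derivatives
`(∇Q)ₖ = DQ eₖ` (`gradient_coord`); differentiate them through the evaluation map
(`ContinuousLinearMap.apply`), conclude differentiability of `∇Q` coordinatewise
(`differentiableAt_euclidean`) and compare derivatives of the `k`-th coordinate by uniqueness (same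
idiom as the tree's `fderiv_gradient_single_apply`). [folklore] -/
private theorem fderiv_gradient_apply {Q : EuclideanSpace ℝ (Fin 3) → ℝ}
    {X : EuclideanSpace ℝ (Fin 3)} (hQ : ContDiffAt ℝ 2 Q X) :
    DifferentiableAt ℝ (gradient Q) X ∧
      ∀ (h : EuclideanSpace ℝ (Fin 3)) (k : Fin 3), fderiv ℝ (gradient Q) X h k =
        fderiv ℝ (fderiv ℝ Q) X h (EuclideanSpace.single k 1) := by
  have hcoord : ∀ k : Fin 3,
      (fun Y => gradient Q Y k) = fun Y => fderiv ℝ Q Y (EuclideanSpace.single k 1) :=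
    fun k => funext fun Y => gradient_coord Q Y k
  have hD : HasFDerivAt (fderiv ℝ Q) (fderiv ℝ (fderiv ℝ Q) X) X :=
    ((hQ.fderiv_right (m := 1) (by norm_num)).differentiableAt one_ne_zero).hasFDerivAt
  have hk : ∀ k : Fin 3, HasFDerivAt (fun Y => gradient Q Y k)
      ((ContinuousLinearMap.apply ℝ ℝ (EuclideanSpace.single k (1 : ℝ))).comp
        (fderiv ℝ (fderiv ℝ Q) X)) X := by
    intro k
    rw [hcoord k]
    exact (ContinuousLinearMap.apply ℝ ℝ (EuclideanSpace.single k (1 : ℝ))).hasFDerivAt.comp X hD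
  have hg : DifferentiableAt ℝ (gradient Q) X :=
    differentiableAt_euclidean.2 fun k => (hk k).differentiableAt
  refine ⟨hg, fun h k => ?_⟩
  have hproj : HasFDerivAt (⇑(PiLp.proj 2 (fun _ : Fin 3 => ℝ) k) ∘ gradient Q)
      ((PiLp.proj 2 (fun _ : Fin 3 => ℝ) k).comp (fderiv ℝ (gradient Q) X)) X :=
    (PiLp.proj 2 (fun _ : Fin 3 => ℝ) k).hasFDerivAt.comp X hg.hasFDerivAt
  have huniq := hproj.unique (hk k)
  have := congrArg (fun L : EuclideanSpace ℝ (Fin 3) →L[ℝ] ℝ => L h) huniq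
  simpa using this

/-- The differentiated Euler equation in coordinates.  If `V`, `Q` are `C²` at `X` and the Euler
expression `Y ↦ DV(Y)[V Y] + ∇Q(Y)` vanishes near `X`, then its derivative at `X` vanishes; by the
product rule for the evaluation `(DV(Y))(V Y)` (Mathlib's `HasFDerivAt.clm_apply`: derivative
`h ↦ DV(X)(DV(X) h) + D²V(X) h (V X)`) and `fderiv_gradient_apply`, the component along `eₘ`,
coordinate `k`, is `Σⱼ aₘⱼ aⱼₖ + Σⱼ vⱼ bₘⱼₖ + qₘₖ = 0` in the notation of the module docstring
(Majda–Bertozzi, §1.2, derivation of the vorticity equation). [folklore] -/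
private theorem fderiv_euler_apply {V : EuclideanSpace ℝ (Fin 3) → EuclideanSpace ℝ (Fin 3)}
    {Q : EuclideanSpace ℝ (Fin 3) → ℝ} {X : EuclideanSpace ℝ (Fin 3)}
    (hV : ContDiffAt ℝ 2 V X) (hQ : ContDiffAt ℝ 2 Q X)
    (hE : (fun Y => fderiv ℝ V Y (V Y) + gradient Q Y) =ᶠ[𝓝 X] fun _ => 0) (m k : Fin 3) :
    ∑ j, fderiv ℝ V X (EuclideanSpace.single m 1) j * fderiv ℝ V X (EuclideanSpace.single j 1) k
      + ∑ j, V X j * fderiv ℝ (fderiv ℝ V) X (EuclideanSpace.single m 1)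
          (EuclideanSpace.single j 1) k
      + fderiv ℝ (fderiv ℝ Q) X (EuclideanSpace.single m 1) (EuclideanSpace.single k 1) = 0 := by
  obtain ⟨hg, hgk⟩ := fderiv_gradient_apply hQ
  have hVd : HasFDerivAt V (fderiv ℝ V X) X := (hV.differentiableAt two_ne_zero).hasFDerivAt
  have hD : HasFDerivAt (fderiv ℝ V) (fderiv ℝ (fderiv ℝ V) X) X :=
    ((hV.fderiv_right (m := 1) (by norm_num)).differentiableAt one_ne_zero).hasFDerivAt
  have hΦ : HasFDerivAt (fun Y => fderiv ℝ V Y (V Y) + gradient Q Y)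
      ((fderiv ℝ V X).comp (fderiv ℝ V X) + (fderiv ℝ (fderiv ℝ V) X).flip (V X)
        + fderiv ℝ (gradient Q) X) X :=
    (hD.clm_apply hVd).add hg.hasFDerivAt
  have h0 : (fderiv ℝ V X).comp (fderiv ℝ V X) + (fderiv ℝ (fderiv ℝ V) X).flip (V X)
      + fderiv ℝ (gradient Q) X = 0 := by
    rw [← hΦ.fderiv, hE.fderiv_eq, fderiv_const_apply]
  have h1 := congrArg
    (fun L : EuclideanSpace ℝ (Fin 3) →L[ℝ] EuclideanSpace ℝ (Fin 3) =>
      L (EuclideanSpace.single m 1) k) h0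
  simp only [_root_.add_apply, ContinuousLinearMap.comp_apply, ContinuousLinearMap.flip_apply,
    _root_.zero_apply, PiLp.add_apply, PiLp.zero_apply] at h1
  rw [clm_apply_coord (fderiv ℝ V X) (fderiv ℝ V X (EuclideanSpace.single m 1)) k,
    clm_apply_coord (fderiv ℝ (fderiv ℝ V) X (EuclideanSpace.single m 1)) (V X) k, hgk] at h1
  exact h1

/-- **Tool stub `stub_steadyEulerCommutesWithCurl` (steady Euler flows: velocity and vorticity
commute).**  For `U ⊆ ℝ³` open, `V : ℝ³ → ℝ³` and `Q : ℝ³ → ℝ` of class `C²` on `U` with `div V = 0`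
and `DV(X)[V X] + ∇Q(X) = 0` on `U` (the steady Euler equation `(V·∇)V + ∇Q = 0`), the vorticity
`ω = curl V` satisfies `(V·∇)ω − (ω·∇)V = 0` on `U`, i.e. `D(curl V)(X)[V X] = DV(X)[curl V X]`.
Proof: differentiate the Euler equation, antisymmetrise, use the symmetry of second derivatives and
`div V = 0`; see the module docstring (Arnold–Khesin, *Topological Methods in Hydrodynamics*, Ch. II
§1; Majda–Bertozzi, *Vorticity and Incompressible Flow*, §1.2, eqs. (1.32)–(1.33)). [folklore] -/
theorem stub_steadyEulerCommutesWithCurl :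
    ∀ (V : EuclideanSpace ℝ (Fin 3) → EuclideanSpace ℝ (Fin 3)) (Q : EuclideanSpace ℝ (Fin 3) → ℝ)
      (U : Set (EuclideanSpace ℝ (Fin 3))), IsOpen U →
      ContDiffOn ℝ 2 V U → ContDiffOn ℝ 2 Q U →
      (∀ X ∈ U, ∑ i : Fin 3, (fderiv ℝ V X (EuclideanSpace.single i (1 : ℝ))) i = 0) →
      (∀ X ∈ U, (fderiv ℝ V X) (V X) + gradient Q X = 0) →
      ∀ X ∈ U, fderiv ℝ (Literature.Analysis.FluidPDE.curl V) X (V X)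
        - fderiv ℝ V X (Literature.Analysis.FluidPDE.curl V X) = 0 := by
  intro V Q U hU hV hQ hdiv hEuler X hX
  have hVX : ContDiffAt ℝ 2 V X := hV.contDiffAt (hU.mem_nhds hX)
  have hQX : ContDiffAt ℝ 2 Q X := hQ.contDiffAt (hU.mem_nhds hX)
  have hEv : (fun Y => fderiv ℝ V Y (V Y) + gradient Q Y) =ᶠ[𝓝 X] fun _ => 0 :=
    Filter.eventually_of_mem (hU.mem_nhds hX) fun Y hY => hEuler Y hY
  -- symmetry of the second derivatives of `V` and `Q` at `X`
  have hSV : ∀ m j : Fin 3,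
      fderiv ℝ (fderiv ℝ V) X (EuclideanSpace.single m 1) (EuclideanSpace.single j 1) =
        fderiv ℝ (fderiv ℝ V) X (EuclideanSpace.single j 1) (EuclideanSpace.single m 1) :=
    fun m j => (hVX.isSymmSndFDerivAt (by simp)).eq _ _
  have hSQ : ∀ m k : Fin 3,
      fderiv ℝ (fderiv ℝ Q) X (EuclideanSpace.single m 1) (EuclideanSpace.single k 1) =
        fderiv ℝ (fderiv ℝ Q) X (EuclideanSpace.single k 1) (EuclideanSpace.single m 1) :=
    fun m k => (hQX.isSymmSndFDerivAt (by simp)).eq _ _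
  -- the divergence constraint and the six differentiated Euler components at `X`
  have hdX := hdiv X hX
  have e01 := fderiv_euler_apply hVX hQX hEv 0 1
  have e10 := fderiv_euler_apply hVX hQX hEv 1 0
  have e02 := fderiv_euler_apply hVX hQX hEv 0 2
  have e20 := fderiv_euler_apply hVX hQX hEv 2 0
  have e12 := fderiv_euler_apply hVX hQX hEv 1 2
  have e21 := fderiv_euler_apply hVX hQX hEv 2 1
  simp only [Fin.sum_univ_three, Fin.isValue] at hdX e01 e10 e02 e20 e12 e21
  simp only [hSV 1 0, hSV 2 0, hSV 2 1, hSQ 1 0, hSQ 2 0, hSQ 2 1] at e01 e10 e02 e20 e12 e21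
  -- reduce the goal to coordinates
  ext i
  rw [PiLp.sub_apply, PiLp.zero_apply, fderiv_curl_apply hVX (V X),
    clm_apply_coord (fderiv ℝ V X) (curl V X) i]
  simp only [clm₂_apply_coord (fderiv ℝ (fderiv ℝ V) X) (V X), curl, Fin.sum_univ_three,
    Fin.isValue, hSV 1 0, hSV 2 0, hSV 2 1]
  fin_cases i
  · simp only [Fin.zero_eta, Fin.isValue, Matrix.cons_val_zero, Matrix.cons_val_one,
      Matrix.cons_val_two, Matrix.head_cons, Matrix.tail_cons]
    linear_combination e12 - e21 - (fderiv ℝ V X (EuclideanSpace.single 1 1) 2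
      - fderiv ℝ V X (EuclideanSpace.single 2 1) 1) * hdX
  · simp only [Fin.mk_one, Fin.isValue, Matrix.cons_val_zero, Matrix.cons_val_one,
      Matrix.cons_val_two, Matrix.head_cons, Matrix.tail_cons]
    linear_combination e20 - e02 - (fderiv ℝ V X (EuclideanSpace.single 2 1) 0
      - fderiv ℝ V X (EuclideanSpace.single 0 1) 2) * hdX
  · simp only [Fin.reduceFinMk, Fin.isValue, Matrix.cons_val_zero, Matrix.cons_val_one,
      Matrix.cons_val_two, Matrix.head_cons, Matrix.tail_cons]
    linear_combination e01 - e10 - (fderiv ℝ V X (EuclideanSpace.single 0 1) 1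
      - fderiv ℝ V X (EuclideanSpace.single 1 1) 0) * hdX

end Summit.AnomalousDissipation.AnomalousDissipation.Theorems.HalfSpaceHierarchy

end
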